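import Mathlib
import HarnessLib
import Summits.HubbardSuperconductivity.HubbardSuperconductivity.Theorems.FunctionFieldCertificateWindowInfraredBoundEngineC

/-!
# Crux `WindowInfraredBound` (stmt-HubbardSuperconductivity-1089) — line `pair-gaussian-domination-energy-form`
# (lead skeleton, lead c2 2026-08-16; stubs registered with `ledger skeleton check`)

Line idea (card `Cruxes/WindowInfraredBound/Ideas/pair-gaussian-domination-energy-form.md`, triage r1-1/r1-2,
planner skeleton of 2026-08-16T09:55Z): TRANSFER the crux to C⁺_λ = `stub_pairGaussianDomination`, a
ONE-SIDED, OWN-BOTTOM, λ_q-REGULARISED GROUND-ENERGY GAUSSIAN DOMINATION in the `d`-wave pair channel: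
for every window momentum `m ≠ 0` and every real source amplitude `t`, the sourced sector-compressed
Hamiltonian `H − μ∓ N̂ − t(Δ_d(m) + Δ_d(m)ᴴ)` on `(N_L ∓ 2, 0) ⊕ (N_L, 0)` (with `μ∓` the one-sided pair
chemical potentials that put the neighbouring bottom `c₀|q_m|²` ABOVE the `N_L` bottom) never dips
below `E(N_L) − μ∓ N_L` by more than `C_χ t² L²/|q_m|²` (KLS (GD) shape, `1/E_q ↦ L²/|q_m|²`).

Composition (all finite-dimensional, this file, sorry-free outside the four `stub_*`):
* `stub_pgdFirstVariation` — first-order variation `ψ + t•w`, `t → 0`, of C⁺_λ at a sector ground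
  state `ψ` gives the λ-regularised torus pair stiffness (T_λ∓):
  `2Re⟨w,Δψ⟩ − (Re⟨w,Hw⟩ − (E∓ − λ)‖w‖²) ≤ X` on `(N∓2,0)`, `X = C_χL²/|q|²`, `λ = c₀|q|²`;
* `stub_pgdRegularisedMomentClosure` — the resolvent-free Pitaevskii–Stringari closure with the
  regulariser `λ` (adaptation of the landed `WcbcsSsbToTorusLRO.stub_momentClosure`):
  `‖Δψ‖² ≤ 2√((B₁ + B₃B₂)X) + (4g + 2λ)X`;
* `stub_chargingFloor` — (Ch) `pairGap H N_L ≥ −κ/L` (physics input shared with engine B);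
* budgets F1/F2/F3 are LANDED (`stub_doubleCommBound` at `μ = 0`, `WcbcsSsbToTorusLRO.stub_pairCommutatorBudget`,
  `wib_twoParticleCost_holds`);
* `goldstoneShape_of_regularisedClosure` + `wib_of_goldstoneShape`, packaged as the LANDED engine C
  `wib_of_pairGaussianDomination_of_chargingFloor` (p100316) ⇒ `WindowInfraredBound_of` (one line).

No definition, no named fact. Sources: Kennedy–Lieb–Shastry, PRL 61 (1988) 2582 and J. Stat. Phys. 53
(1988) 1019 (ground-state Gaussian domination ⇒ infrared bound); Dyson–Lieb–Simon, J. Stat. Phys. 18 (1978)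
335; Pitaevskii–Stringari, J. Low Temp. Phys. 85 (1991) 377; Lin–Hirsch–Scalapino, PRB 37 (1988) 7359
(one-sided pair chemical potentials).
-/

namespace Summit.HubbardSuperconductivity.HubbardSuperconductivity.Theorems.WindowInfraredBound

-- summit = problem name (single-conjunct summit, D-0017): `HubbardSuperconductivity` occurs twice in the path
set_option linter.dupNamespace false

open Literature.MathematicalPhysics.QuantumLattice Literature.Probability.LatticeModels Matrix Finset
open scoped ComplexOrder ComplexConjugate
open Summit.HubbardSuperconductivity.HubbardSuperconductivity.Theses

/-! ## The stubs (FV `stub_pgdFirstVariation` LANDED p96685, RMC `stub_pgdRegularisedMomentClosure` LANDED p96461 — imported) -/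

/-- **Stub C⁺_λ — `stub_pairGaussianDomination` (HARDEST; the transfer target of the line).** One-sided,
own-bottom, `λ_q`-regularised ground-energy Gaussian domination in the `d`-wave pair channel of the doped
Hubbard torus: for all `U > 0`, `δ ∈ (0,1/2)` there are `C_χ, c₀ ≥ 0`, `η > 0`, `L₀` such that for every even
`L ≥ L₀`, every window momentum `0 < |q_m| ≤ η` and every real `t`, with `H = hubbardTorus 2 L 1 U`,
`N = N_L = 2⌊(1-δ)L²/2⌋`, `E(M) = H.minEnergyOn (szSector M 0)`, `Δ = pairFieldAt dWaveFormFactor L m`,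
`μ₋ = (E(N) − E(N−2) + c₀|q_m|²)/2`, `μ₊ = (E(N+2) − E(N) − c₀|q_m|²)/2`:
`E(N) − μ∓N − C_χ (L²/|q_m|²) t² ≤ minEnergyOn (H − μ∓N̂ − t(Δ + Δᴴ)) ((N∓2,0) ⊔ (N,0))`.
OPEN physics input (no reflection positivity off half filling); a hypothesis of the line, proved nowhere.
Kennedy–Lieb–Shastry (1988) eqs. (17)–(19); Dyson–Lieb–Simon (1978) Thm 4.2 (shape). -/
theorem stub_pairGaussianDomination :
    ∀ U : ℝ, 0 < U → ∀ δ ∈ Set.Ioo (0:ℝ) (1 / 2), ∃ C_χ c₀ η : ℝ, 0 ≤ C_χ ∧ 0 ≤ c₀ ∧ 0 < η ∧ ∃ L₀ : ℕ,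
      ∀ (L : ℕ) [NeZero L], L₀ ≤ L → Even L → ∀ m : TorusSite 2 L, m ≠ 0 → momentumNormSq L m ≤ η ^ 2 →
        ∀ t : ℝ,
          ((hubbardTorus 2 L 1 U).minEnergyOn (szSector (2 * ⌊(1 - δ) * (L : ℝ) ^ 2 / 2⌋₊) 0) -
              ((hubbardTorus 2 L 1 U).minEnergyOn (szSector (2 * ⌊(1 - δ) * (L : ℝ) ^ 2 / 2⌋₊) 0) -
                  (hubbardTorus 2 L 1 U).minEnergyOn (szSector (2 * ⌊(1 - δ) * (L : ℝ) ^ 2 / 2⌋₊ - 2) 0) +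
                  c₀ * momentumNormSq L m) / 2 * ((2 * ⌊(1 - δ) * (L : ℝ) ^ 2 / 2⌋₊ : ℕ) : ℝ) -
              C_χ * (L : ℝ) ^ 2 / momentumNormSq L m * t ^ 2 ≤
            (hubbardTorus 2 L 1 U -
              ((((hubbardTorus 2 L 1 U).minEnergyOn (szSector (2 * ⌊(1 - δ) * (L : ℝ) ^ 2 / 2⌋₊) 0) -
                  (hubbardTorus 2 L 1 U).minEnergyOn (szSector (2 * ⌊(1 - δ) * (L : ℝ) ^ 2 / 2⌋₊ - 2) 0) +
                  c₀ * momentumNormSq L m) / 2 : ℝ) : ℂ) •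
                (totalNumber : Matrix (Finset (Orb (FermionTorus 2 L))) (Finset (Orb (FermionTorus 2 L))) ℂ) -
              (t : ℂ) • (pairFieldAt dWaveFormFactor L m + (pairFieldAt dWaveFormFactor L m)ᴴ)).minEnergyOn
              (szSector (2 * ⌊(1 - δ) * (L : ℝ) ^ 2 / 2⌋₊ - 2) 0 ⊔
                szSector (2 * ⌊(1 - δ) * (L : ℝ) ^ 2 / 2⌋₊) 0)) ∧
          ((hubbardTorus 2 L 1 U).minEnergyOn (szSector (2 * ⌊(1 - δ) * (L : ℝ) ^ 2 / 2⌋₊) 0) -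
              ((hubbardTorus 2 L 1 U).minEnergyOn (szSector (2 * ⌊(1 - δ) * (L : ℝ) ^ 2 / 2⌋₊ + 2) 0) -
                  (hubbardTorus 2 L 1 U).minEnergyOn (szSector (2 * ⌊(1 - δ) * (L : ℝ) ^ 2 / 2⌋₊) 0) -
                  c₀ * momentumNormSq L m) / 2 * ((2 * ⌊(1 - δ) * (L : ℝ) ^ 2 / 2⌋₊ : ℕ) : ℝ) -
              C_χ * (L : ℝ) ^ 2 / momentumNormSq L m * t ^ 2 ≤
            (hubbardTorus 2 L 1 U -
              ((((hubbardTorus 2 L 1 U).minEnergyOn (szSector (2 * ⌊(1 - δ) * (L : ℝ) ^ 2 / 2⌋₊ + 2) 0) -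
                  (hubbardTorus 2 L 1 U).minEnergyOn (szSector (2 * ⌊(1 - δ) * (L : ℝ) ^ 2 / 2⌋₊) 0) -
                  c₀ * momentumNormSq L m) / 2 : ℝ) : ℂ) •
                (totalNumber : Matrix (Finset (Orb (FermionTorus 2 L))) (Finset (Orb (FermionTorus 2 L))) ℂ) -
              (t : ℂ) • (pairFieldAt dWaveFormFactor L m + (pairFieldAt dWaveFormFactor L m)ᴴ)).minEnergyOn
              (szSector (2 * ⌊(1 - δ) * (L : ℝ) ^ 2 / 2⌋₊) 0 ⊔
                szSector (2 * ⌊(1 - δ) * (L : ℝ) ^ 2 / 2⌋₊ + 2) 0)) := by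
  sorry

/-- **Stub Ch — `stub_chargingFloor` (physics input (Ch), shared with engine B).** The pair charging energy
of the `(N_L, 0)` sector is bounded below at scale `1/L`: `pairGap H N_L = (E(N_L+2) + E(N_L−2) − 2E(N_L))/2 ≥ −κ/L`
eventually in even `L`, for all `U > 0`, `δ ∈ (0,1/2)` (near pair-convexity of the sector ground energies;
`O(1/L²)` expected from a convex equation of state, open-shell exchange gives `−cU/L²`). OPEN physics input.
Lin–Hirsch–Scalapino (1988) eq. (9). -/
theorem stub_chargingFloor :
    ∀ U : ℝ, 0 < U → ∀ δ ∈ Set.Ioo (0:ℝ) (1 / 2), ∃ κ : ℝ, 0 ≤ κ ∧ ∃ L₀ : ℕ, ∀ (L : ℕ) [NeZero L],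
      L₀ ≤ L → Even L → -(κ / (L : ℝ)) ≤ pairGap (hubbardTorus 2 L 1 U) (2 * ⌊(1 - δ) * (L : ℝ) ^ 2 / 2⌋₊) := by
  sorry

/-! ## The composition (sorry-free below this line; everything finite-dimensional is LANDED as engine C) -/

/-- **The line closes the crux (modulo its stubs): `WindowInfraredBound_of`.** C⁺_λ
(`stub_pairGaussianDomination`) ⇒ [first variation, p96685] (T_λ∓) ⇒ [regularised moment closure p96461 with the
landed budgets F1/F2/F3 and the charging floor (Ch)] Goldstone shape `S_ψ(m)|q_m| ≤ A` on the window ⇒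
[`wib_of_goldstoneShape`] `FunctionFieldCertificate.WindowInfraredBound` — all of it the landed engine C
`wib_of_pairGaussianDomination_of_chargingFloor` (p100316). -/
theorem WindowInfraredBound_of : FunctionFieldCertificate.WindowInfraredBound :=
  wib_of_pairGaussianDomination_of_chargingFloor stub_pairGaussianDomination stub_chargingFloor

/-- The `KacWindowPenalty` copy of the crux (verbatim the same proposition, `wib_functionField_iff_kac`). -/
theorem WindowInfraredBound_of_kac : KacWindowPenalty.WindowInfraredBound :=
  wib_functionField_iff_kac.1 WindowInfraredBound_of

end Summit.HubbardSuperconductivity.HubbardSuperconductivity.Theorems.WindowInfraredBound
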